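import Literature.Computability.Cryptography.HallgrenPellQuantum
import HarnessLib

/-!
# Hallgren's regulator algorithm over an abstract infrastructure, IV: padding the input and rescaling the output

Topic `Computability/Cryptography`; the last generic layer around the regulator theorem of
`HallgrenRegulatorGenericSampling/Post.lean` (Jozsa 2003, §10 Thm. 6–7): a solver of the relation
"on admissible `u`, output `⟨bin m, ·⟩` with `|m − N(|u|)·ρ(u)| ≤ 10`" (grid `N(n) = 2^{2n+12}` of
the tree's shift experiment) is turned, by a polynomial-time PRE-processor `h` (parse and pad the input,
so that the parameter functions of `|h w|` dominate the instance) and the POST-processor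
`⟨w, ⟨bin m, t⟩⟩ ↦ ⟨bin ⌊m 2^{k(w)} / N(|h w|)⌉, ε⟩`, into a solver of "on `w` with `h w` admissible,
output `⟨bin r, ·⟩` with `|r − 2^{k(w)} ρ(h w)| ≤ 1`" (`N(|h w|) ≥ 2^{k(w)+5}` makes the rescaled error
`10 · 2^k / N + 1/2 ≤ 1`). This is Bernstein–Vazirani's "classical computation is free inside `BQP`"
(`isQSolvable_classicalWrap_holds`) with the rounding `HallgrenQuantum.rdiv_eq_round`; it is how a
regulator known to `±10` grid units is reported to any requested absolute precision `2^{−k}`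
(Jozsa 2003, Thm. 7: "the closest integer above or below R"; here scaled by `2^k`).

* **`isQSolvable_rescale_gen`**.

Theorem-only file, no named facts, no definitions.

## References

* R. Jozsa, arXiv:quant-ph/0302134 (2003), §10 Thm. 6, Thm. 7. [Jozsa2003]
* E. Bernstein, U. Vazirani, *Quantum complexity theory*, SIAM J. Comput. 26 (1997), §8. [BernsteinVazirani1997]
* S. Arora, B. Barak, *Computational Complexity*, CUP 2009, §1.3. [AroraBarak2009]
-/

noncomputable section

namespace Literature.Computability.Cryptography

namespace HallgrenQuantum

open _root_.Computability Complexity Complexity.CodeFP Brick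

/-- **Padding the input and rescaling the output of a generic regulator solver.** If `h ∈ FP`,
`k : {0,1}* → ℕ` is polynomial time (in unary), `N(|h w|) ≥ 2^{k(w)+5}` whenever `h w` is admissible,
and the relation "on admissible `u`, `⟨bin m, t⟩` with `|m − N(|u|) ρ(u)| ≤ 10`" is `IsQSolvable`, then so
is "on `w` with `h w` admissible, `⟨bin r, t⟩` with `|r − 2^{k(w)} ρ(h w)| ≤ 1`": run the solver on `h w`
and output `r = ⌊m 2^{k(w)} / N(|h w|)⌉`, so that
`|r − 2^k ρ| ≤ 1/2 + (2^k/N)|m − Nρ| ≤ 1/2 + 10/32`. [cite: Jozsa2003, §10 Thm. 7] [cite: BernsteinVazirani1997, §8] -/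
theorem isQSolvable_rescale_gen {Adm : List Bool → Prop} {ρ : List Bool → ℝ} {h : List Bool → List Bool}
    {kOf : List Bool → ℕ} (hh : h ∈ FP) (hk : CodeFP strE unE kOf)
    (hN : ∀ w, Adm (h w) → 2 ^ (kOf w + 5) ≤ Ngrid (h w).length)
    (hsolv : IsQSolvable fun u => {y | Adm u → ∃ (m : ℕ) (t : List Bool),
      y = boolPair (encodeNat m) t ∧ |(m : ℝ) - Ngrid u.length * ρ u| ≤ 10}) :
    IsQSolvable fun w => {z | Adm (h w) → ∃ (r : ℕ) (t : List Bool),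
      z = boolPair (encodeNat r) t ∧ |(r : ℝ) - 2 ^ kOf w * ρ (h w)| ≤ 1} := by
  -- the post-processor `⟨w, ⟨bin m, t⟩⟩ ↦ ⟨bin ⌊m 2^k / N⌉, ε⟩` is polynomial time
  have hw : CodeFP (pairE strE strE) strE (fun c => c.1) := fst _ _
  have hy : CodeFP (pairE strE strE) strE (fun c => c.2) := snd _ _
  have hfst : CodeFP strE strE fstF := of_fn fstF fstF_mem_FP fun _ => rfl
  have hm : CodeFP (pairE strE strE) natE (fun c => bitsToNat (fstF c.2)) := (strVal.comp (hfst.comp hy) :)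
  have hhw : CodeFP (pairE strE strE) strE (fun c => h c.1) := ((of_fn h hh fun _ => rfl : CodeFP strE strE h).comp hw :)
  have hNc : CodeFP (pairE strE strE) natE (fun c => Ngrid (h c.1).length) := (Ngrid_nat.comp (strLength.comp hhw) :)
  have h2k : CodeFP (pairE strE strE) natE (fun c => 2 ^ kOf c.1) := (natPow.comp ((const _ (2 : ℕ)).pair (hk.comp hw)) :)
  have hr : CodeFP (pairE strE strE) natE
      (fun c => rdiv (bitsToNat (fstF c.2) * 2 ^ kOf c.1) (Ngrid (h c.1).length)) := by
    have hnum : CodeFP (pairE strE strE) natE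
        (fun c => 2 * (bitsToNat (fstF c.2) * 2 ^ kOf c.1) + Ngrid (h c.1).length) :=
      (natAdd.comp ((natMul.comp ((const _ (2 : ℕ)).pair (natMul.comp (hm.pair h2k)))).pair hNc) :)
    have hden : CodeFP (pairE strE strE) natE (fun c => 2 * Ngrid (h c.1).length) :=
      (natMul.comp ((const _ (2 : ℕ)).pair hNc) :)
    exact ((natDiv.comp (hnum.pair hden)) :).congr fun c => rfl
  obtain ⟨g, hg, hge⟩ : CodeFP (pairE strE strE) strE
      (fun c => boolPair (encodeNat (rdiv (bitsToNat (fstF c.2) * 2 ^ kOf c.1) (Ngrid (h c.1).length))) []) := by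
    obtain ⟨F, hF, hFe⟩ := hr.pair (const _ ([] : List Bool) : CodeFP (pairE strE strE) strE fun _ => [])
    exact ⟨F, hF, hFe⟩
  -- wrap the solver
  have hW := isQSolvable_classicalWrap_holds h g hh hg hsolv
  refine hW.mono fun w z hz => ?_
  obtain ⟨y, hyR, hpre⟩ := hz
  intro hadm
  obtain ⟨m, t, rfl, hmρ⟩ := hyR hadm
  have hgy : g (boolPair w (boolPair (encodeNat m) t)) =
      boolPair (encodeNat (rdiv (m * 2 ^ kOf w) (Ngrid (h w).length))) [] := by
    have e := hge (w, boolPair (encodeNat m) t)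
    simp only [pairE_apply, strE, id_eq, fstF_boolPair] at e
    rw [e, bitsToNat_encodeNat]
  rw [hgy] at hpre
  obtain ⟨t', rfl⟩ := hpre
  refine ⟨rdiv (m * 2 ^ kOf w) (Ngrid (h w).length), t', by simp [boolPair], ?_⟩
  -- the estimate `|r − 2^k ρ| ≤ 1/2 + 10 · 2^k / N ≤ 1`
  have hNpos := Ngrid_pos (h w).length
  have hN0 : (0 : ℝ) < Ngrid (h w).length := by exact_mod_cast hNpos
  have hN32 : (2 : ℝ) ^ kOf w * 32 ≤ Ngrid (h w).length := by
    have e : 2 ^ kOf w * 32 ≤ Ngrid (h w).length := by have := hN w hadm; rw [pow_add] at this; exact this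
    exact_mod_cast e
  have hr : ((rdiv (m * 2 ^ kOf w) (Ngrid (h w).length) : ℕ) : ℝ) =
      round (((m * 2 ^ kOf w : ℕ) : ℝ) / (Ngrid (h w).length : ℝ)) := by
    exact_mod_cast rdiv_eq_round (a := m * 2 ^ kOf w) hNpos
  have h1 := abs_sub_round (((m * 2 ^ kOf w : ℕ) : ℝ) / (Ngrid (h w).length : ℝ))
  have h2 : |((m * 2 ^ kOf w : ℕ) : ℝ) / (Ngrid (h w).length : ℝ) - 2 ^ kOf w * ρ (h w)| ≤
      10 * 2 ^ kOf w / Ngrid (h w).length := by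
    have e : ((m * 2 ^ kOf w : ℕ) : ℝ) / (Ngrid (h w).length : ℝ) - 2 ^ kOf w * ρ (h w) =
        (2 ^ kOf w / Ngrid (h w).length) * ((m : ℝ) - Ngrid (h w).length * ρ (h w)) := by
      push_cast; field_simp
    rw [e, abs_mul, abs_of_pos (by positivity)]
    calc (2 : ℝ) ^ kOf w / Ngrid (h w).length * |(m : ℝ) - Ngrid (h w).length * ρ (h w)|
        ≤ 2 ^ kOf w / Ngrid (h w).length * 10 := mul_le_mul_of_nonneg_left hmρ (by positivity)
      _ = 10 * 2 ^ kOf w / Ngrid (h w).length := by ring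
  have h3 : 10 * (2 : ℝ) ^ kOf w / Ngrid (h w).length ≤ 10 / 32 := by
    rw [div_le_div_iff₀ hN0 (by norm_num)]; nlinarith
  rw [hr]
  calc |(round (((m * 2 ^ kOf w : ℕ) : ℝ) / (Ngrid (h w).length : ℝ)) : ℝ) - 2 ^ kOf w * ρ (h w)|
      ≤ |(round (((m * 2 ^ kOf w : ℕ) : ℝ) / (Ngrid (h w).length : ℝ)) : ℝ) -
          ((m * 2 ^ kOf w : ℕ) : ℝ) / (Ngrid (h w).length : ℝ)| +
        |((m * 2 ^ kOf w : ℕ) : ℝ) / (Ngrid (h w).length : ℝ) - 2 ^ kOf w * ρ (h w)| := abs_sub_le _ _ _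
    _ ≤ 1 / 2 + 10 / 32 := by rw [abs_sub_comm] at h1; linarith
    _ ≤ 1 := by norm_num

end HallgrenQuantum

end Literature.Computability.Cryptography

end
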